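import Literature.NumberTheory.LFunctions.FordZetaZeroDetector
import Literature.NumberTheory.LFunctions.DirichletLogNormVertical
import Literature.NumberTheory.LFunctions.KhaleLemma41
import Literature.Analysis.Complex.LittlewoodLemma
import HarnessLib

/-!
# Ford's zero detector for `L(s, χ)` on whole vertical lines (Khale 2024, Lemma 6.1 for `f = L(·, χ)`, `χ ≠ χ₀`)

Topic `Literature/NumberTheory/LFunctions`.  Everything in this file is PROVED; no definition, no
named fact.  This is the Dirichlet-`L`-function companion of `FordZetaZeroDetector.lean`.

Lemma 6.1 of T. Khale, *An explicit Vinogradov–Korobov zero-free region for Dirichlet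
L-functions*, Q. J. Math. 75 (2024) = arXiv:2210.06457 (= Lemma 2.2 of Ford, *Zero-free regions
for the Riemann zeta function*, 2002) is Jensen's formula in a vertical strip: for `f` the quotient
of two entire functions of finite order, `z₀` neither zero nor pole, and almost every `η > 0`,

  `−Re f'(z₀)/f(z₀) = (π/2η) Σ_{|Re(z₀−ω)| ≤ η} m_ω Re cot(π(ω − z₀)/2η)`
  `    + (1/4η) ∫_{−∞}^{∞} [log|f(z₀ − η + 2ηiu/π)| − log|f(z₀ + η + 2ηiu/π)|] sech²u du`.

Lemma 6.2 of the source applies it to `f = L(s, χ)` (times `s^{…}` for the trivial zero / pole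
bookkeeping).  The tree has the identity on finite rectangles for any analytic `f`
(`Literature.Analysis.Complex.FordDetector.ford_zero_detector_rect`, with explicit horizontal-edge
terms).  This file lets the horizontal edges recede for `f = L(·, χ)`, `χ ≠ χ₀` (entire, no pole),
and packages the result, exactly as `FordZetaDetector.neg_re_deriv_riemannZeta₁_div_le` does for
`ζ₁`, as an **upper bound** for `−Re L'/L(s, χ)` in which any zeros may be omitted (for `Re s ≥ 1`
every zero enters with `Re h_η(ρ − s) ≤ 0`):

* `DirichletDetector.exists_goodHeight` — good heights for every `χ ≠ χ₀` mod every `q`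
  (pigeonhole on the Jensen counts of `DirichletLogDerivDisc.lean`; no functional equation is
  needed since only zeros with `Re ρ ≥ 19/50` near the heights `±T` matter): every `[τ₀, τ₀ + 1]`,
  `τ₀ ≥ 0`, contains `T` with `|Im ρ ∓ T| ≥ c₀/ℒ(T)` for every zero with `Re ρ ≥ 19/50`,
  `ℒ(T) = log q + log(T + 4)`, `c₀` absolute;
* `DirichletDetector.exists_norm_logDeriv_LFunction_edge_le` — `|L'/L(x + iT)| ≤ C ℒ(T)/δ + 1` on
  `1/2 ≤ x ≤ 3` at such a height (the disc partial fraction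
  `DirichletDisc.exists_norm_logDeriv_le_of_dist` on `[1/2, 2]`, `|L'/L| < 1/(x−1) < 1` beyond);
* `DirichletDetector.neg_re_logDeriv_LFunction_le` — **the detector on whole lines**: for
  `s = σ + it`, `σ ≥ 1`, `η > 0`, `1/2 ≤ σ − η`, `σ + η ≤ 3`, no zero of `L(·, χ)` on `Re z = σ − η`,
  and `S` any finite set of zeros with `Re ρ > σ − η`:
  `−Re (L'/L)(s, χ) ≤ Σ_{ρ∈S} m(ρ) Re h_η(ρ − s) + (π/8η²)[∫ log|L(σ−η+iy, χ)| k − ∫ log|L(σ+η+iy, χ)| k]`,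
  `k(y) = sech²(π(y − t)/2η)`, `h_η(z) = (π/2η)cot(πz/2η)`, `m = DirichletDisc.zeroOrder χ`
  (integrals over `ℝ`, absolutely convergent by `DirichletLogNormVertical`);
* `DirichletDetector.ford_zero_detector_LFunction` — Ford's/Khale's parametrisation
  `y = t + 2ηu/π`: `… + (1/4η)[∫ log|L(σ−η+i(t+2ηu/π), χ)|/cosh²u du − ∫ log|L(σ+η+i(t+2ηu/π), χ)|/cosh²u du]`.

The principal character (pole at `s = 1`) is not treated here; the hypothesis "no zero on
`Re z = σ − η`" (Ford's "good `η`"; the bad ones are countably many) is removed downstream, as on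
the `ζ` side (`FordZetaZeroDetectorLimit.lean`).

## Proof

As in `FordZetaZeroDetector.lean`: good heights `T_n ∈ [n, n+1]`; on `[σ−η, σ+η] × {±T_n}`,
`|L'/L| ≤ C ℒ(T_n)²/c₀ + 1 ≤ A (T_n + 4)²`; `ford_zero_detector_rect` on `[σ−η, σ+η] × [−T_n, T_n]`;
the zeros outside `S` have `σ − η < Re ρ < 1 ≤ σ` and enter with `Re h_η ≤ 0`
(`FordDetector.re_fordCot_nonpos`); the horizontal terms are `≪ (T_n+4)² e^{−π(T_n − |t|)/η} → 0`;
and `∫_{−T_n}^{T_n} → ∫_ℝ` by the integrability of `log|L(x + iy, χ)| sech²` on the lines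
`x ∈ [1/2, 3]` (`DirichletLogNormVertical.integrable_log_norm_LFunction_div_cosh_sq`).

## References

* T. Khale, arXiv:2210.06457v1, Lemmas 6.1, 6.2. [Khale2024]
* K. Ford, *Zero-free regions for the Riemann zeta function*, Number Theory for the Millennium II
  (Urbana 2000), A K Peters 2002, 25–56 (arXiv:1910.08205): Lemma 2.2, Lemma 4.1 and its proof.
  [Ford2002Millennium]
* H. L. Montgomery, R. C. Vaughan, *Multiplicative Number Theory I*, CUP 2007, Lemmas 12.6–12.7,
  Thm. 10.13 (through `DirichletLogDerivDisc.lean`). [MontgomeryVaughan2007]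
-/

noncomputable section

open Complex Set Metric Filter Topology MeasureTheory Real intervalIntegral
open Literature.Analysis.Complex Literature.Analysis.Complex.FordDetector

namespace Literature.NumberTheory.LFunctions

namespace DirichletDetector

open DirichletDisc

variable {q : ℕ} [NeZero q] {χ : DirichletCharacter ℂ q}

/-! ### Zeros in a disc are finite; zeros in a unit window lie in a Jensen disc -/

/-- The zeros of `L(·, χ)` (`χ ≠ χ₀`) in a closed disc form a finite set. [folklore] -/
theorem finite_zeros_closedBall (hχ : χ ≠ 1) (c : ℂ) (R : ℝ) :
    {ρ : ℂ | ρ ∈ closedBall c R ∧ χ.LFunction ρ = 0}.Finite := by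
  have h := (MeromorphicOn.divisor χ.LFunction (closedBall c R)).finiteSupport (isCompact_closedBall c R)
  refine h.subset ?_
  rintro ρ ⟨hρ, h0⟩
  rw [Function.mem_support, MeromorphicOn.divisor_apply (analyticOnNhd_LFunction χ hχ c R).meromorphicOn hρ,
    meromorphicOrderAt_untop₀_eq_zeroOrder χ hχ]
  have := (zeroOrder_pos_iff χ hχ ρ).2 h0
  exact_mod_cast this.ne'

omit [NeZero q] in
/-- A zero with `Re ρ ≥ 19/50`, `Re ρ < 1` and `|Im ρ − τ| ≤ 1/2` lies in the disc
`|s − (2 + iτ)| ≤ 17/10` (`(81/50)² + 1/4 ≤ (17/10)²`). [folklore] -/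
theorem mem_closedBall_of_window' {ρ : ℂ} {τ : ℝ} (h1 : 19 / 50 ≤ ρ.re) (h2 : ρ.re < 1)
    (h3 : |ρ.im - τ| ≤ 1 / 2) : ρ ∈ closedBall (2 + (τ : ℂ) * I) (17 / 10) := by
  rw [mem_closedBall, dist_eq_norm, ← sq_le_sq₀ (norm_nonneg _) (by norm_num), Complex.sq_norm,
    Complex.normSq_apply]
  simp only [sub_re, add_re, re_ofNat, mul_re, ofReal_re, I_re, mul_zero, ofReal_im, I_im,
    mul_one, sub_self, add_zero, sub_im, add_im, im_ofNat, mul_im, zero_add]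
  rw [abs_le] at h3
  nlinarith

/-- Every zero of `L(·, χ)` (`χ ≠ χ₀`) has `Re ρ < 1`. [folklore] -/
theorem re_lt_one_of_LFunction_eq_zero (hχ : χ ≠ 1) {ρ : ℂ} (h : χ.LFunction ρ = 0) : ρ.re < 1 := by
  by_contra hre
  exact DirichletCharacter.LFunction_ne_zero_of_one_le_re χ (Or.inl hχ) (not_lt.1 hre) h

/-! ### Good heights for every non-principal character -/

/-- The pigeonhole step: if `⌊(v − τ₀)(2M+1)⌋ ≠ k` then `v` is `≥ 1/(2(2M+1))` away from the
centre `T = τ₀ + (k + 1/2)/(2M+1)` of the `k`-th subinterval. [folklore] -/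
theorem pigeonhole_dist {v τ₀ : ℝ} {M k : ℕ} (hne : ⌊(v - τ₀) * (2 * M + 1)⌋₊ ≠ k) :
    (1 / 2) / (2 * (M : ℝ) + 1) ≤ |v - (τ₀ + ((k : ℝ) + 1 / 2) / (2 * M + 1))| := by
  have hM1 : (0 : ℝ) < 2 * M + 1 := by positivity
  set y : ℝ := (v - τ₀) * (2 * M + 1) with hy
  have hyT : v - (τ₀ + ((k : ℝ) + 1 / 2) / (2 * M + 1)) = (y - (k + 1 / 2)) / (2 * M + 1) := by
    rw [hy]; field_simp; ring
  rw [hyT, abs_div, abs_of_pos hM1, div_le_div_iff_of_pos_right hM1]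
  have hk0 : (0 : ℝ) ≤ k := k.cast_nonneg
  rcases lt_or_ge y 0 with hy0 | hy0
  · rw [abs_of_neg (by linarith)]
    linarith
  have hcase : y < k ∨ (k : ℝ) + 1 ≤ y := by
    by_contra hcon
    rw [not_or, not_lt, not_le] at hcon
    exact hne ((Nat.floor_eq_iff hy0).2 ⟨hcon.1, hcon.2⟩)
  rcases hcase with h | h
  · rw [abs_of_neg (by linarith)]; linarith
  · rw [abs_of_nonneg (by linarith)]; linarith

/-- Covering `[-9/4, 9/4]` by the five unit windows centred at `−2, −1, 0, 1, 2`. [folklore] -/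
theorem exists_window_of_abs_le {u : ℝ} (hu : |u| ≤ 9 / 4) :
    ∃ k : Fin 5, |u - (((k : ℕ) : ℝ) - 2)| ≤ 1 / 2 := by
  obtain ⟨hlo, hhi⟩ := abs_le.1 hu
  have hfl := Nat.floor_le (by linarith : 0 ≤ u + 5 / 2)
  have hfl2 := Nat.lt_floor_add_one (u + 5 / 2)
  rcases le_or_gt ⌊u + 5 / 2⌋₊ 4 with h4 | h4
  · refine ⟨⟨⌊u + 5 / 2⌋₊, by omega⟩, ?_⟩
    rw [abs_le]
    constructor <;> push_cast <;> linarith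
  · refine ⟨⟨4, by omega⟩, ?_⟩
    have h5 : (5 : ℝ) ≤ ⌊u + 5 / 2⌋₊ := by exact_mod_cast h4
    rw [abs_le]
    constructor <;> push_cast <;> linarith

/-- **Good heights, all `χ ≠ χ₀`, uniformly in `q`.** There is an absolute `c₀ ∈ (0, 1/2]` such
that for every `q`, every `χ ≠ χ₀` mod `q` and every `τ₀ ≥ 0`, the interval `[τ₀, τ₀ + 1]` contains
a `T` with `|Im ρ − T| ≥ c₀/ℒ(T)` and `|Im ρ + T| ≥ c₀/ℒ(T)` for every zero `ρ` of `L(s, χ)` with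
`Re ρ ≥ 19/50` (`ℒ(T) = log q + log(T + 4)`).  Pigeonhole on `2M + 1` subintervals, `M ≪ ℒ` the
number of such zeros with `Im ρ` or `−Im ρ` within `9/4` of `τ₀ + 1/2` (ten Jensen discs of
`DirichletLogDerivDisc.lean`). [cite: MontgomeryVaughan2007, Lemma 12.7] -/
theorem exists_goodHeight :
    ∃ c₀ : ℝ, 0 < c₀ ∧ c₀ ≤ 1 / 2 ∧ ∀ (q : ℕ) [NeZero q] (χ : DirichletCharacter ℂ q), χ ≠ 1 →
      ∀ τ₀ : ℝ, 0 ≤ τ₀ → ∃ T ∈ Icc τ₀ (τ₀ + 1),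
        ∀ ρ : ℂ, χ.LFunction ρ = 0 → 19 / 50 ≤ ρ.re →
          c₀ / (Real.log q + Real.log (|T| + 4)) ≤ |ρ.im - T| ∧
          c₀ / (Real.log q + Real.log (|T| + 4)) ≤ |ρ.im + T| := by
  obtain ⟨C, hC0, hC⟩ := exists_sum_zeroOrder_le_of_subset_closedBall (R := 17 / 10)
    (by norm_num) (by norm_num)
  refine ⟨1 / (80 * C + 2), by positivity, ?_, fun q _ χ hχ τ₀ hτ₀ ↦ ?_⟩
  · rw [div_le_div_iff₀ (by positivity) (by norm_num)]; nlinarith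
  classical
  set c : ℝ := τ₀ + 1 / 2 with hc
  -- the relevant zeros (each once) and their number `M`
  set Wset : Set ℂ := {ρ | χ.LFunction ρ = 0 ∧ 19 / 50 ≤ ρ.re ∧
    (|ρ.im - c| ≤ 9 / 4 ∨ |ρ.im + c| ≤ 9 / 4)} with hWset
  -- ten windows: heights `±(c + k - 2)`, `k = 0, …, 4`
  have hcover : ∀ ρ ∈ Wset, ∃ k : Fin 5, |ρ.im - (c + ((k : ℕ) : ℝ) - 2)| ≤ 1 / 2 ∨
      |ρ.im - (-(c + ((k : ℕ) : ℝ) - 2))| ≤ 1 / 2 := by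
    rintro ρ ⟨-, -, h⟩
    rcases h with h | h
    · obtain ⟨k, hk⟩ := exists_window_of_abs_le h
      refine ⟨k, Or.inl ?_⟩
      rwa [show ρ.im - (c + ((k : ℕ) : ℝ) - 2) = ρ.im - c - (((k : ℕ) : ℝ) - 2) by ring]
    · have h' : |(-ρ.im - c)| ≤ 9 / 4 := by
        rw [show -ρ.im - c = -(ρ.im + c) by ring, abs_neg]; exact h
      obtain ⟨k, hk⟩ := exists_window_of_abs_le h'
      refine ⟨k, Or.inr ?_⟩
      rwa [show ρ.im - -(c + ((k : ℕ) : ℝ) - 2) = -(-ρ.im - c - (((k : ℕ) : ℝ) - 2)) by ring, abs_neg]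
  have hWfin : Wset.Finite := by
    refine (Set.Finite.biUnion (Set.finite_univ (α := Fin 5)) fun k _ ↦
      (finite_zeros_closedBall hχ (2 + ((c + ((k : ℕ) : ℝ) - 2 : ℝ) : ℂ) * I) (17 / 10)).union
        (finite_zeros_closedBall hχ (2 + ((-(c + ((k : ℕ) : ℝ) - 2) : ℝ) : ℂ) * I) (17 / 10))).subset ?_
    intro ρ hρ
    obtain ⟨k, hk⟩ := hcover ρ hρ
    obtain ⟨h0, hre, -⟩ := hρ
    have hlt := re_lt_one_of_LFunction_eq_zero hχ h0
    refine mem_iUnion₂.2 ⟨k, mem_univ _, ?_⟩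
    rcases hk with hk | hk
    · exact Or.inl ⟨mem_closedBall_of_window' hre hlt hk, h0⟩
    · exact Or.inr ⟨mem_closedBall_of_window' hre hlt hk, h0⟩
  set W := hWfin.toFinset with hW
  obtain ⟨M, hM⟩ : ∃ M : ℕ, W.card = M := ⟨_, rfl⟩
  have hM1 : (0 : ℝ) < 2 * M + 1 := by positivity
  -- pigeonhole with the two maps `ρ ↦ ⌊(±Im ρ − τ₀)(2M+1)⌋`
  let φ₁ : ℂ → ℕ := fun ρ ↦ ⌊(ρ.im - τ₀) * (2 * M + 1)⌋₊
  let φ₂ : ℂ → ℕ := fun ρ ↦ ⌊(-ρ.im - τ₀) * (2 * M + 1)⌋₊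
  have hcard : (W.image φ₁ ∪ W.image φ₂).card < (Finset.range (2 * M + 1)).card := by
    rw [Finset.card_range]
    calc (W.image φ₁ ∪ W.image φ₂).card ≤ (W.image φ₁).card + (W.image φ₂).card :=
          Finset.card_union_le _ _
      _ ≤ M + M := add_le_add (Finset.card_image_le.trans hM.le) (Finset.card_image_le.trans hM.le)
      _ < 2 * M + 1 := by omega
  obtain ⟨k, hk, hkφ⟩ := Finset.exists_mem_notMem_of_card_lt_card hcard
  rw [Finset.mem_range] at hk
  rw [Finset.mem_union, not_or] at hkφ
  set T : ℝ := τ₀ + ((k : ℝ) + 1 / 2) / (2 * M + 1) with hT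
  have hk1 : (k : ℝ) + 1 ≤ 2 * M + 1 := by exact_mod_cast hk
  have hTlo : τ₀ + (1 / 2) / (2 * M + 1) ≤ T := by
    rw [hT]; gcongr; linarith [(k.cast_nonneg : (0 : ℝ) ≤ k)]
  have hThi : T ≤ τ₀ + 1 - (1 / 2) / (2 * M + 1) := by
    rw [hT, add_sub_assoc, add_le_add_iff_left, le_sub_iff_add_le, ← add_div, div_le_one hM1]
    linarith
  have hδ0 : (0 : ℝ) < (1 / 2) / (2 * M + 1) := by positivity
  have hT0 : 0 ≤ T := by linarith
  have hTc : |T - c| ≤ 1 / 2 := by rw [hc, abs_le]; constructor <;> linarith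
  refine ⟨T, ⟨by linarith, by linarith⟩, fun ρ h0 hre ↦ ?_⟩
  -- Step 1: both distances `≥ 1/(2(2M+1))`
  have hfar : (1 / 2) / (2 * (M : ℝ) + 1) ≤ |ρ.im - T| ∧ (1 / 2) / (2 * (M : ℝ) + 1) ≤ |ρ.im + T| := by
    by_cases hwin : |ρ.im - c| ≤ 9 / 4 ∨ |ρ.im + c| ≤ 9 / 4
    · have hρW : ρ ∈ W := by
        rw [hW, Set.Finite.mem_toFinset]
        exact ⟨h0, hre, hwin⟩
      have hne1 : φ₁ ρ ≠ k := fun h ↦ hkφ.1 (Finset.mem_image.2 ⟨ρ, hρW, h⟩)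
      have hne2 : φ₂ ρ ≠ k := fun h ↦ hkφ.2 (Finset.mem_image.2 ⟨ρ, hρW, h⟩)
      refine ⟨pigeonhole_dist hne1, ?_⟩
      have := pigeonhole_dist hne2
      rwa [show -ρ.im - (τ₀ + ((k : ℝ) + 1 / 2) / (2 * M + 1)) = -(ρ.im + T) by rw [hT]; ring,
        abs_neg] at this
    · rw [not_or, not_le, not_le] at hwin
      have h1 := abs_sub_abs_le_abs_sub (ρ.im - c) (T - c)
      have h2 := abs_sub_abs_le_abs_sub (ρ.im + c) (c - T)
      rw [show ρ.im - c - (T - c) = ρ.im - T by ring] at h1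
      rw [show ρ.im + c - (c - T) = ρ.im + T by ring] at h2
      have h3 : |c - T| ≤ 1 / 2 := by rw [abs_sub_comm]; exact hTc
      have h4 : (1 / 2 : ℝ) / (2 * M + 1) ≤ 1 / 2 := by
        rw [div_le_iff₀ hM1]; nlinarith [(M.cast_nonneg : (0 : ℝ) ≤ M)]
      constructor <;> linarith
  -- Step 2: `2M + 1 ≤ (80 C + 2) ℒ(T)`
  set ℒ : ℝ := Real.log q + Real.log (|T| + 4) with hℒ
  have hℒ1 : 1 ≤ ℒ := DirichletZFR.one_le_ell q T
  have hlogq : 0 ≤ Real.log (q : ℝ) := Real.log_natCast_nonneg q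
  have hwin_le : ∀ (t : ℝ), |t| ≤ c + 2 → ∀ P : Finset ℂ,
      (∀ u ∈ P, u ∈ closedBall (2 + (t : ℂ) * I) (17 / 10) ∧ χ.LFunction u = 0) →
      (P.card : ℝ) ≤ C * (2 * ℒ) := by
    intro t ht P hP
    have h1 : (P.card : ℝ) ≤ ∑ ρ ∈ P, (zeroOrder χ ρ : ℝ) := by
      rw [Finset.card_eq_sum_ones, Nat.cast_sum]
      refine Finset.sum_le_sum fun ρ hρ ↦ ?_
      simp only [Nat.cast_one]
      exact_mod_cast (zeroOrder_pos_iff χ hχ ρ).2 (hP ρ hρ).2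
    have h2 := hC q χ hχ t P hP
    have h3 : Real.log (|t| + 4) ≤ 2 * Real.log (|T| + 4) := by
      calc Real.log (|t| + 4) ≤ Real.log ((|T| + 4) ^ 2) := by
            refine Real.log_le_log (by positivity) ?_
            rw [abs_of_nonneg hT0]
            nlinarith [abs_nonneg t]
        _ = 2 * Real.log (|T| + 4) := by rw [Real.log_pow]; norm_num
    have h4 : Real.log q + Real.log (|t| + 4) ≤ 2 * ℒ := by rw [hℒ]; linarith
    exact h1.trans (h2.trans (mul_le_mul_of_nonneg_left h4 hC0.le))
  have hMle : (M : ℝ) ≤ 10 * (C * (2 * ℒ)) := by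
    have hsub : W ⊆ (Finset.univ : Finset (Fin 5)).biUnion fun k ↦
        (W.filter fun ρ ↦ |ρ.im - (c + ((k : ℕ) : ℝ) - 2)| ≤ 1 / 2) ∪
        (W.filter fun ρ ↦ |ρ.im - (-(c + ((k : ℕ) : ℝ) - 2))| ≤ 1 / 2) := by
      intro ρ hρ
      have hρ' : ρ ∈ Wset := by rwa [hW, Set.Finite.mem_toFinset] at hρ
      obtain ⟨k, hk⟩ := hcover ρ hρ'
      rw [Finset.mem_biUnion]
      refine ⟨k, Finset.mem_univ _, ?_⟩
      rw [Finset.mem_union, Finset.mem_filter, Finset.mem_filter]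
      rcases hk with hk | hk
      · exact Or.inl ⟨hρ, hk⟩
      · exact Or.inr ⟨hρ, hk⟩
    have hprop : ∀ ρ ∈ W, χ.LFunction ρ = 0 ∧ 19 / 50 ≤ ρ.re ∧ ρ.re < 1 := by
      intro ρ hρ
      rw [hW, Set.Finite.mem_toFinset] at hρ
      exact ⟨hρ.1, hρ.2.1, re_lt_one_of_LFunction_eq_zero hχ hρ.1⟩
    have hk_abs : ∀ k : Fin 5, |c + ((k : ℕ) : ℝ) - 2| ≤ c + 2 := by
      intro k
      have hk : ((k : ℕ) : ℝ) ≤ 4 := by exact_mod_cast Nat.lt_succ_iff.mp k.isLt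
      have hk0 : (0 : ℝ) ≤ (k : ℕ) := Nat.cast_nonneg _
      rw [abs_le]; constructor <;> linarith
    calc (M : ℝ) = W.card := by rw [hM]
      _ ≤ ((Finset.univ : Finset (Fin 5)).biUnion fun k ↦
            (W.filter fun ρ ↦ |ρ.im - (c + ((k : ℕ) : ℝ) - 2)| ≤ 1 / 2) ∪
            (W.filter fun ρ ↦ |ρ.im - (-(c + ((k : ℕ) : ℝ) - 2))| ≤ 1 / 2)).card := by
          exact_mod_cast Finset.card_le_card hsub
      _ ≤ ∑ k : Fin 5, (((W.filter fun ρ ↦ |ρ.im - (c + ((k : ℕ) : ℝ) - 2)| ≤ 1 / 2) ∪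
            (W.filter fun ρ ↦ |ρ.im - (-(c + ((k : ℕ) : ℝ) - 2))| ≤ 1 / 2)).card : ℝ) := by
          exact_mod_cast Finset.card_biUnion_le
      _ ≤ ∑ _k : Fin 5, (C * (2 * ℒ) + C * (2 * ℒ)) := by
          refine Finset.sum_le_sum fun k _ ↦ ?_
          set P₁ := W.filter fun ρ ↦ |ρ.im - (c + ((k : ℕ) : ℝ) - 2)| ≤ 1 / 2 with hP₁
          set P₂ := W.filter fun ρ ↦ |ρ.im - (-(c + ((k : ℕ) : ℝ) - 2))| ≤ 1 / 2 with hP₂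
          have hu : ((P₁ ∪ P₂).card : ℝ) ≤ P₁.card + P₂.card := by
            exact_mod_cast Finset.card_union_le P₁ P₂
          refine hu.trans (add_le_add (hwin_le _ (hk_abs k) P₁ fun u hu ↦ ?_)
            (hwin_le _ (by rw [abs_neg]; exact hk_abs k) P₂ fun u hu ↦ ?_))
          · rw [hP₁, Finset.mem_filter] at hu
            obtain ⟨h0, hre, hlt⟩ := hprop u hu.1
            exact ⟨mem_closedBall_of_window' hre hlt hu.2, h0⟩
          · rw [hP₂, Finset.mem_filter] at hu
            obtain ⟨h0, hre, hlt⟩ := hprop u hu.1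
            exact ⟨mem_closedBall_of_window' hre hlt hu.2, h0⟩
      _ = 10 * (C * (2 * ℒ)) := by simp; ring
  have hℒ0 : 0 < ℒ := by linarith
  have hM' : 2 * (M : ℝ) + 1 ≤ (80 * C + 2) * ℒ := by nlinarith
  have hkey : 1 / (80 * C + 2) / ℒ ≤ (1 / 2) / (2 * (M : ℝ) + 1) := by
    rw [div_div, div_le_div_iff₀ (by positivity) hM1]
    nlinarith
  exact ⟨hkey.trans hfar.1, hkey.trans hfar.2⟩

/-! ### `L'/L` on the horizontal edges at good heights -/

/-- **`L'/L` on a horizontal segment at a good height, uniformly in `q`.** There is an absolute `C`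
such that for every `q`, `χ ≠ χ₀` mod `q`, real `T`, `0 < δ ≤ 1` with every zero `ρ` of `L(s, χ)`
with `Re ρ ≥ 19/50` at distance `|Im ρ − T| ≥ δ`, and `1/2 ≤ x ≤ 3`: `L(x + iT, χ) ≠ 0` and
`‖L'/L(x + iT, χ)‖ ≤ C ℒ(T)/δ + 1`. [cite: MontgomeryVaughan2007, Lemma 12.6] -/
theorem exists_norm_logDeriv_LFunction_edge_le :
    ∃ C : ℝ, 0 < C ∧ ∀ (q : ℕ) [NeZero q] (χ : DirichletCharacter ℂ q), χ ≠ 1 → ∀ (T δ : ℝ),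
      0 < δ → δ ≤ 1 → (∀ ρ : ℂ, χ.LFunction ρ = 0 → 19 / 50 ≤ ρ.re → δ ≤ |ρ.im - T|) →
      ∀ x : ℝ, x ∈ Icc (1 / 2 : ℝ) 3 →
        χ.LFunction (x + T * I) ≠ 0 ∧
        ‖deriv χ.LFunction (x + T * I) / χ.LFunction (x + T * I)‖ ≤
          C * (Real.log q + Real.log (|T| + 4)) / δ + 1 := by
  obtain ⟨C, hC0, hC⟩ := exists_norm_logDeriv_le_of_dist
  refine ⟨2 * C, by positivity, fun q _ χ hχ T δ hδ hδ1 hsep x hx ↦ ?_⟩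
  set z : ℂ := (x : ℂ) + T * I with hz
  set ℒ : ℝ := Real.log q + Real.log (|T| + 4) with hℒ
  have hℒ1 : 1 ≤ ℒ := DirichletZFR.one_le_ell q T
  have hpos : 0 ≤ 2 * C * ℒ / δ := by positivity
  rcases le_or_gt x 2 with hx2 | hx2
  · have hzmem : z ∈ closedBall (2 + (T : ℂ) * I) (38 / 25) := by
      have h := DirichletDisc.mem_closedBall_of_re_mem_Icc (σ := x) (t := T) (t' := T) ⟨hx.1, hx2⟩
        (by rw [sub_self, abs_zero]; norm_num)
      simpa only [hz] using h
    have hdist : ∀ ρ ∈ discZeros χ T, δ ≤ ‖z - ρ‖ := by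
      intro ρ hρ
      obtain ⟨h0, -, hre, -⟩ := discZeros_prop hχ hρ
      refine (hsep ρ h0 hre).trans ?_
      have h1 := abs_im_le_norm (z - ρ)
      rw [sub_im, show z.im = T by simp [hz]] at h1
      rwa [abs_sub_comm]
    obtain ⟨hL, hbd⟩ := hC q χ hχ T z hzmem δ hδ hdist
    refine ⟨hL, ?_⟩
    rw [← logDeriv_apply]
    refine hbd.trans ?_
    have h1 : 1 ≤ 1 / δ := by rw [le_div_iff₀ hδ]; linarith
    have h2 : C * (1 + 1 / δ) * ℒ ≤ C * (2 * (1 / δ)) * ℒ := by gcongr; linarith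
    have e : C * (2 * (1 / δ)) * ℒ = 2 * C * ℒ / δ := by ring
    linarith
  · have hre1 : 1 < z.re := by simp [hz]; linarith
    have hL : χ.LFunction z ≠ 0 :=
      DirichletCharacter.LFunction_ne_zero_of_one_le_re χ (Or.inl hχ) hre1.le
    refine ⟨hL, ?_⟩
    have h1 := KhaleL41.norm_logDeriv_LFunction_lt χ (s := z) hre1
    have h2 : 1 / (z.re - 1) < 1 := by
      have : z.re = x := by simp [hz]
      rw [this, div_lt_one (by linarith)]; linarith
    linarith

/-! ### The horizontal-edge term for `L(·, χ)` at a good height -/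

/-- **The horizontal-edge term for `L(·, χ)` at a good height.** For `s = σ + it`, `1/2 ≤ σ − η`,
`σ + η ≤ 3`, `η > 0`, a height `y` with `|y| ≥ |t| + 2` whose distance from the ordinate of every
zero with `Re ρ ≥ 19/50` is `≥ δ ∈ (0, 1]`, and the constant `C` of
`exists_norm_logDeriv_LFunction_edge_le`:
`‖H(y)‖ ≤ (2η)² (C ℒ(y)/δ + 1) (π/2η)² · 16 e^{−π(|y| − |t|)/η}`, `ℒ(y) = log q + log(|y| + 4)`.
[cite: Ford2002Millennium, §2, proof of Lemma 2.2] -/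
theorem norm_fordHorizontalTerm_LFunction_le (hχ : χ ≠ 1) {σ η t y δ C : ℝ} (hη : 0 < η)
    (hleft : 1 / 2 ≤ σ - η) (hright : σ + η ≤ 3)
    (hC : ∀ (T δ : ℝ), 0 < δ → δ ≤ 1 →
      (∀ ρ : ℂ, χ.LFunction ρ = 0 → 19 / 50 ≤ ρ.re → δ ≤ |ρ.im - T|) →
      ∀ x : ℝ, x ∈ Icc (1 / 2 : ℝ) 3 →
        χ.LFunction (x + T * I) ≠ 0 ∧
        ‖deriv χ.LFunction (x + T * I) / χ.LFunction (x + T * I)‖ ≤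
          C * (Real.log q + Real.log (|T| + 4)) / δ + 1)
    (hδ0 : 0 < δ) (hδ1 : δ ≤ 1)
    (hsep : ∀ ρ : ℂ, χ.LFunction ρ = 0 → 19 / 50 ≤ ρ.re → δ ≤ |ρ.im - y|)
    (hy : |t| + 2 ≤ |y|) :
    ‖fordHorizontalTerm χ.LFunction η ((σ : ℂ) + t * I) (σ - η) (σ + η) y‖ ≤
      (2 * η) ^ 2 * (C * (Real.log q + Real.log (|y| + 4)) / δ + 1) *
        ((π / (2 * η)) ^ 2 * (16 * Real.exp (-(2 * (π / (2 * η) * (|y| - |t|)))))) := by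
  set ν : ℝ := π / (2 * η) with hν
  have hν0 : 0 < ν := by positivity
  have hM : ∀ x ∈ Icc (σ - η) (σ + η),
      ‖deriv χ.LFunction (x + y * I) / χ.LFunction (x + y * I)‖ ≤
        C * (Real.log q + Real.log (|y| + 4)) / δ + 1 :=
    fun x hx ↦ (hC y δ hδ0 hδ1 hsep x ⟨by linarith [hx.1], by linarith [hx.2]⟩).2
  have hF : ∀ x ∈ Icc (σ - η) (σ + η),
      ContinuousAt (fun z ↦ deriv χ.LFunction z / χ.LFunction z) (x + y * I) := fun x hx ↦
    continuousAt_logDeriv ((DirichletCharacter.differentiable_LFunction hχ).analyticAt _)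
      (hC y δ hδ0 hδ1 hsep x ⟨by linarith [hx.1], by linarith [hx.2]⟩).1
  have hab : σ - η ≤ σ + η := by linarith
  have hyt : y ≠ ((σ : ℂ) + t * I).im := by
    simp only [add_im, ofReal_im, mul_im, ofReal_re, I_im, mul_one, I_re, mul_zero, add_zero, zero_add]
    intro h; rw [h] at hy; linarith
  have H := norm_fordHorizontalTerm_le (f := χ.LFunction) (z₀ := (σ : ℂ) + t * I) hη hab hF hM hyt
  have him : ((σ : ℂ) + t * I).im = t := by simp
  rw [him, show σ + η - (σ - η) = 2 * η by ring] at H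
  refine H.trans (mul_le_mul_of_nonneg_left ?_ ?_)
  · have hν1 : 1 / 2 ≤ ν := by
      rw [hν, le_div_iff₀ (by positivity)]
      have := Real.pi_gt_three
      nlinarith
    refine FordZetaDetector.kernel_edge_decay hν0 (by nlinarith) ?_
    have := abs_sub_abs_le_abs_sub y t
    linarith
  · have h0 := (norm_nonneg _).trans (hM (σ - η) ⟨le_rfl, hab⟩)
    exact mul_nonneg (by positivity) h0

/-- `ℒ(d) = log q + log(d + 4) ≤ (log q + 1)(d + 4)` for `d ≥ 0`. [folklore] -/
theorem ell_le_mul {d : ℝ} (hd : 0 ≤ d) (q : ℕ) :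
    Real.log q + Real.log (d + 4) ≤ (Real.log q + 1) * (d + 4) := by
  have hlog : Real.log (d + 4) ≤ d + 3 := by
    have := Real.log_le_sub_one_of_pos (by linarith : 0 < d + 4); linarith
  have hlogq : 0 ≤ Real.log (q : ℝ) := Real.log_natCast_nonneg q
  nlinarith

/-! ### The detector for `L(·, χ)` on whole lines -/

set_option maxHeartbeats 800000 in
/-- **Ford's zero detector for `L(s, χ)`, `χ ≠ χ₀`, on whole vertical lines** (Khale 2024, Lemma 6.1
= Ford 2002, Lemma 2.2, with `f = L(·, χ)`, `T → ∞` carried out, inequality form). Let `χ ≠ χ₀`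
be a Dirichlet character modulo `q ≥ 1`, `s = σ + it`, `σ ≥ 1`, `η > 0` with `1/2 ≤ σ − η`,
`σ + η ≤ 3`, assume no zero of `L(·, χ)` lies on the line `Re z = σ − η`, and let `S` be any finite
set of zeros of `L(·, χ)` with `Re ρ > σ − η`. Then, with `h_η(z) = (π/2η) cot(πz/2η)` and
`m(ρ) = zeroOrder χ ρ` the multiplicity,
`−Re (L'/L)(s, χ) ≤ Σ_{ρ ∈ S} m(ρ) Re h_η(ρ − s)`
`   + (π/8η²) [∫ log|L(σ−η+iy, χ)| sech²(π(y−t)/2η) dy − ∫ log|L(σ+η+iy, χ)| sech²(π(y−t)/2η) dy]`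
(integrals over `ℝ`, absolutely convergent by `DirichletLogNormVertical`).
[cite: Khale2024, Lemma 6.1] [cite: Ford2002Millennium, Lemma 2.2 and proof of Lemma 4.1] -/
theorem neg_re_logDeriv_LFunction_le (hχ : χ ≠ 1) {σ t η : ℝ} (hη : 0 < η) (hσ : 1 ≤ σ)
    (hleft : 1 / 2 ≤ σ - η) (hright : σ + η ≤ 3)
    (hgood : ∀ ρ : ℂ, χ.LFunction ρ = 0 → ρ.re ≠ σ - η)
    (S : Finset ℂ) (hS : ∀ ρ ∈ S, χ.LFunction ρ = 0 ∧ σ - η < ρ.re) :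
    -(deriv χ.LFunction (σ + t * I) / χ.LFunction (σ + t * I)).re ≤
      (∑ ρ ∈ S, (zeroOrder χ ρ : ℝ) * (fordCot η (ρ - (σ + t * I))).re)
      + π / (8 * η ^ 2) *
        ((∫ y : ℝ, Real.log ‖χ.LFunction ((σ - η : ℝ) + y * I)‖ / Real.cosh (π / (2 * η) * (y - t)) ^ 2)
          - ∫ y : ℝ, Real.log ‖χ.LFunction ((σ + η : ℝ) + y * I)‖ / Real.cosh (π / (2 * η) * (y - t)) ^ 2) := by
  classical
  obtain ⟨c₀, hc₀, hc₀2, hgh⟩ := exists_goodHeight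
  obtain ⟨C, hC0, hC⟩ := exists_norm_logDeriv_LFunction_edge_le
  have hCχ := hC q χ hχ
  have hchoice : ∀ n : ℕ, ∃ d : ℝ, (n : ℝ) ≤ d ∧ d ≤ n + 1 ∧
      ∀ ρ : ℂ, χ.LFunction ρ = 0 → 19 / 50 ≤ ρ.re →
        c₀ / (Real.log q + Real.log (|d| + 4)) ≤ |ρ.im - d| ∧
        c₀ / (Real.log q + Real.log (|d| + 4)) ≤ |ρ.im + d| := by
    intro n
    obtain ⟨T, hT, hsep⟩ := hgh q χ hχ n (Nat.cast_nonneg n)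
    exact ⟨T, hT.1, hT.2, hsep⟩
  choose d hd_ge hd_le hδsep using hchoice
  -- the separations `δ n = c₀/ℒ(d n)`
  set δ : ℕ → ℝ := fun n ↦ c₀ / (Real.log q + Real.log (|d n| + 4)) with hδ
  have hℒd : ∀ n, 1 ≤ Real.log q + Real.log (|d n| + 4) := fun n ↦ DirichletZFR.one_le_ell q (d n)
  have hδ0 : ∀ n, 0 < δ n := fun n ↦ by simp only [hδ]; exact div_pos hc₀ (by linarith [hℒd n])
  have hδ1 : ∀ n, δ n ≤ 1 := fun n ↦ by
    simp only [hδ]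
    rw [div_le_one (by linarith [hℒd n])]
    linarith [hℒd n]
  -- notation
  set s : ℂ := (σ : ℂ) + t * I with hs
  set ν : ℝ := π / (2 * η) with hν
  have hν0 : 0 < ν := by positivity
  set F : ℂ → ℂ := fun z ↦ deriv χ.LFunction z / χ.LFunction z with hF
  set G : ℝ → ℝ := fun y ↦ (Real.log ‖χ.LFunction ((σ - η : ℝ) + y * I)‖ -
    Real.log ‖χ.LFunction ((σ + η : ℝ) + y * I)‖) / Real.cosh (ν * (y - t)) ^ 2 with hG
  set ZS : ℝ := ∑ ρ ∈ S, (zeroOrder χ ρ : ℝ) * (fordCot η (ρ - s)).re with hZS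
  have hsre : s.re = σ := by simp [hs]
  have hsim : s.im = t := by simp [hs]
  have hdiff := DirichletCharacter.differentiable_LFunction hχ
  -- integrability on the two lines
  have hIL := DirichletLogNormVertical.integrable_log_norm_LFunction_div_cosh_sq hχ
    (σ := σ - η) ⟨hleft, by linarith⟩ hν0 t
  have hIR := DirichletLogNormVertical.integrable_log_norm_LFunction_div_cosh_sq hχ
    (σ := σ + η) ⟨by linarith, hright⟩ hν0 t
  have hGint : Integrable G := by
    refine (hIL.sub hIR).congr (ae_of_all _ fun y ↦ ?_)
    simp only [hG, Pi.sub_apply, sub_div]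
  have hGeq : ∫ y, G y = (∫ y : ℝ, Real.log ‖χ.LFunction ((σ - η : ℝ) + y * I)‖ / Real.cosh (ν * (y - t)) ^ 2)
      - ∫ y : ℝ, Real.log ‖χ.LFunction ((σ + η : ℝ) + y * I)‖ / Real.cosh (ν * (y - t)) ^ 2 := by
    rw [← integral_sub hIL hIR]
    refine integral_congr_ae (ae_of_all _ fun y ↦ ?_)
    simp only [hG, sub_div]
  -- non-vanishing
  have h0 : χ.LFunction s ≠ 0 :=
    DirichletCharacter.LFunction_ne_zero_of_one_le_re χ (Or.inl hχ) (by rw [hsre]; exact hσ)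
  have h_left : ∀ y : ℝ, χ.LFunction ((σ - η : ℝ) + y * I) ≠ 0 := fun y h0' ↦
    hgood _ h0' (by simp)
  have h_right : ∀ y : ℝ, χ.LFunction ((σ + η : ℝ) + y * I) ≠ 0 := fun y ↦
    DirichletCharacter.LFunction_ne_zero_of_one_le_re χ (Or.inl hχ) (by simp; linarith)
  have h_hor : ∀ n : ℕ, ∀ x ∈ Icc (σ - η) (σ + η),
      χ.LFunction (x + d n * I) ≠ 0 ∧ χ.LFunction (x + (-d n : ℝ) * I) ≠ 0 := by
    intro n x hx
    have hx' : x ∈ Icc (1 / 2 : ℝ) 3 := ⟨by linarith [hx.1], by linarith [hx.2]⟩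
    refine ⟨(hCχ (d n) (δ n) (hδ0 n) (hδ1 n) (fun ρ hρ hre ↦ (hδsep n ρ hρ hre).1) x hx').1, ?_⟩
    have h := (hCχ (-d n) (δ n) (hδ0 n) (by exact hδ1 n)
      (fun ρ hρ hre ↦ by have := (hδsep n ρ hρ hre).2; rwa [sub_neg_eq_add]) x hx').1
    simpa using h
  -- Step A: the finite-rectangle identity at the good heights `± d n`, `n ≥ |t| + 2`
  have hrect : ∀ n : ℕ, |t| + 2 ≤ (n : ℝ) →
      -(F s).re =
        (∑ᶠ ρ ∈ {ρ : ℂ | χ.LFunction ρ = 0 ∧ ρ ∈ Ioo (σ - η) (σ + η) ×ℂ Ioo (-d n) (d n)},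
            ((meromorphicOrderAt χ.LFunction ρ).untop₀ : ℝ) * (fordCot η (ρ - s)).re)
        + π / (8 * η ^ 2) * (∫ y : ℝ in (-d n : ℝ)..d n, G y)
        - 1 / (2 * π) * ((fordHorizontalTerm χ.LFunction η s (σ - η) (σ + η) (d n)).im
            - (fordHorizontalTerm χ.LFunction η s (σ - η) (σ + η) (-d n)).im) := by
    intro n hn
    have hdn : |t| < d n := by linarith [hd_ge n]
    have hc : -d n < t := by have := neg_abs_le t; linarith
    have hd : t < d n := lt_of_le_of_lt (le_abs_self t) hdn
    have h := ford_zero_detector_rect (f := χ.LFunction) (x₀ := σ) (y₀ := t) (c := -d n)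
      (d := d n) hη hc hd (fun z _ ↦ hdiff.analyticAt z)
      (fun x hx ↦ (h_hor n x hx).2) (fun x hx ↦ (h_hor n x hx).1)
      (fun y _ ↦ h_left y) (fun y _ ↦ h_right y) h0
    simp only [hF, hG, hν]
    rw [h]
  -- Step B: the zeros outside `S` enter with a non-positive sign
  obtain ⟨NS, hNS⟩ : ∃ NS : ℕ, ∀ ρ ∈ S, |ρ.im| + 1 ≤ NS := by
    obtain ⟨B, hB⟩ := (S.image fun ρ ↦ |ρ.im| + 1).exists_le
    refine ⟨⌈max B 0⌉₊, fun ρ hρ ↦ ?_⟩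
    have h1 : |ρ.im| + 1 ≤ B := hB _ (Finset.mem_image_of_mem _ hρ)
    exact h1.trans ((le_max_left B 0).trans (Nat.le_ceil _))
  have hzeros : ∀ n : ℕ, |t| + 2 ≤ (n : ℝ) → (NS : ℝ) ≤ n →
      (∑ᶠ ρ ∈ {ρ : ℂ | χ.LFunction ρ = 0 ∧ ρ ∈ Ioo (σ - η) (σ + η) ×ℂ Ioo (-d n) (d n)},
          ((meromorphicOrderAt χ.LFunction ρ).untop₀ : ℝ) * (fordCot η (ρ - s)).re) ≤ ZS := by
    intro n hn hnS
    have hdn : |t| < d n := by linarith [hd_ge n]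
    have hc : -d n < t := by have := neg_abs_le t; linarith
    have hd : t < d n := lt_of_le_of_lt (le_abs_self t) hdn
    have hab : σ - η ≤ σ + η := by linarith
    have hsK : s ∈ Icc (σ - η) (σ + η) ×ℂ Icc (-d n) (d n) :=
      ⟨⟨by rw [hsre]; linarith, by rw [hsre]; linarith⟩, ⟨by rw [hsim]; exact hc.le, by rw [hsim]; exact hd.le⟩⟩
    have hfin := finite_zeros_reProdIm hab (by linarith : -d n ≤ d n)
      (fun z _ ↦ hdiff.analyticAt z) hsK h0
    rw [finsum_mem_eq_finite_toFinset_sum _ hfin]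
    set Z := hfin.toFinset with hZ
    have hmemZ : ∀ ρ, ρ ∈ Z ↔ χ.LFunction ρ = 0 ∧ ρ ∈ Ioo (σ - η) (σ + η) ×ℂ Ioo (-d n) (d n) :=
      fun ρ ↦ by rw [hZ, Set.Finite.mem_toFinset]; rfl
    have hZprop : ∀ ρ ∈ Z, σ - η < ρ.re ∧ ρ.re < 1 ∧
        ((meromorphicOrderAt χ.LFunction ρ).untop₀ : ℝ) = zeroOrder χ ρ := by
      intro ρ hρ
      obtain ⟨h0ρ, hρR⟩ := (hmemZ ρ).1 hρ
      refine ⟨hρR.1.1, re_lt_one_of_LFunction_eq_zero hχ h0ρ, ?_⟩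
      rw [meromorphicOrderAt_untop₀_eq_zeroOrder χ hχ ρ]
      simp
    have hSZ : S ⊆ Z := by
      intro ρ hρ
      obtain ⟨hL0, hre⟩ := hS ρ hρ
      have hlt : ρ.re < 1 := re_lt_one_of_LFunction_eq_zero hχ hL0
      have him : |ρ.im| < d n := by
        have := hNS ρ hρ
        linarith [hd_ge n]
      rw [hmemZ]
      refine ⟨hL0, ⟨hre, by linarith⟩, ?_⟩
      rw [abs_lt] at him
      exact ⟨him.1, him.2⟩
    rw [← Finset.sum_sdiff hSZ]
    have hneg : ∑ ρ ∈ Z \ S, ((meromorphicOrderAt χ.LFunction ρ).untop₀ : ℝ) *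
        (fordCot η (ρ - s)).re ≤ 0 := by
      refine Finset.sum_nonpos fun ρ hρ ↦ ?_
      rw [Finset.mem_sdiff] at hρ
      obtain ⟨hre, hlt, hm⟩ := hZprop ρ hρ.1
      have hm0 : 0 ≤ ((meromorphicOrderAt χ.LFunction ρ).untop₀ : ℝ) := by
        rw [hm]; exact Nat.cast_nonneg _
      refine mul_nonpos_of_nonneg_of_nonpos hm0 (re_fordCot_nonpos hη ?_ ?_)
      · rw [sub_re, hsre]; linarith
      · rw [sub_re, hsre]; linarith
    have hpos : ∑ ρ ∈ S, ((meromorphicOrderAt χ.LFunction ρ).untop₀ : ℝ) * (fordCot η (ρ - s)).re = ZS := by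
      refine Finset.sum_congr rfl fun ρ hρ ↦ ?_
      rw [(hZprop ρ (hSZ hρ)).2.2]
    linarith
  -- Step C: the horizontal-edge terms
  set Lq : ℝ := Real.log q + 1 with hLq
  have hLq1 : 1 ≤ Lq := by
    rw [hLq]; linarith [Real.log_natCast_nonneg (q : ℕ)]
  set A : ℝ := C * Lq ^ 2 / c₀ + 1 with hA
  set Bc : ℝ := 1 / (2 * π) * 2 * ((2 * η) ^ 2 * A * (ν ^ 2 * (16 * Real.exp (2 * ν * |t|)))) with hBc
  set E : ℕ → ℝ := fun n ↦ Bc * ((d n + 4) ^ 2 * Real.exp (-(2 * ν * d n))) with hE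
  have hhor : ∀ n : ℕ, |t| + 2 ≤ (n : ℝ) →
      |1 / (2 * π) * ((fordHorizontalTerm χ.LFunction η s (σ - η) (σ + η) (d n)).im
          - (fordHorizontalTerm χ.LFunction η s (σ - η) (σ + η) (-d n)).im)| ≤ E n := by
    intro n hn
    have hdpos : 0 ≤ d n := by linarith [abs_nonneg t, hd_ge n]
    have hyd : |t| + 2 ≤ |d n| := by rw [abs_of_nonneg hdpos]; linarith [hd_ge n]
    have hyc : |t| + 2 ≤ |(-d n)| := by rwa [abs_neg]
    have Hd := norm_fordHorizontalTerm_LFunction_le hχ hη hleft hright hCχ (hδ0 n) (hδ1 n)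
      (fun ρ hρ hre ↦ (hδsep n ρ hρ hre).1) hyd
    have Hc := norm_fordHorizontalTerm_LFunction_le hχ hη hleft hright hCχ (hδ0 n) (hδ1 n)
      (fun ρ hρ hre ↦ by have := (hδsep n ρ hρ hre).2; rwa [sub_neg_eq_add]) hyc
    rw [abs_neg, abs_of_nonneg hdpos] at Hc
    rw [abs_of_nonneg hdpos] at Hd
    -- the edge bound is `≤ A (d n + 4)²`
    have hMle : C * (Real.log q + Real.log (d n + 4)) / δ n + 1 ≤ A * (d n + 4) ^ 2 := by
      have hℒ := ell_le_mul hdpos q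
      have hℒ0 : 0 ≤ Real.log q + Real.log (d n + 4) := by
        have := hℒd n; rw [abs_of_nonneg hdpos] at this; linarith
      have e1 : C * (Real.log q + Real.log (d n + 4)) / δ n =
          C * (Real.log q + Real.log (d n + 4)) ^ 2 / c₀ := by
        simp only [hδ]; rw [abs_of_nonneg hdpos]; field_simp
      rw [e1, hA, add_mul, one_mul]
      have h1 : (Real.log q + Real.log (d n + 4)) ^ 2 ≤ (Lq * (d n + 4)) ^ 2 :=
        pow_le_pow_left₀ hℒ0 hℒ 2
      have h2 : C * (Real.log q + Real.log (d n + 4)) ^ 2 / c₀ ≤ C * Lq ^ 2 / c₀ * (d n + 4) ^ 2 := by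
        rw [div_mul_eq_mul_div, div_le_div_iff_of_pos_right hc₀]
        nlinarith
      have h3 : (1 : ℝ) ≤ (d n + 4) ^ 2 := by nlinarith
      linarith
    have hexp : Real.exp (-(2 * (ν * (d n - |t|)))) = Real.exp (2 * ν * |t|) * Real.exp (-(2 * ν * d n)) := by
      rw [← Real.exp_add]; ring_nf
    have hK0 : 0 ≤ ν ^ 2 * (16 * Real.exp (-(2 * (ν * (d n - |t|))))) := by positivity
    have key : ‖fordHorizontalTerm χ.LFunction η s (σ - η) (σ + η) (d n)‖ +
        ‖fordHorizontalTerm χ.LFunction η s (σ - η) (σ + η) (-d n)‖ ≤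
          2 * ((2 * η) ^ 2 * (A * (d n + 4) ^ 2) * (ν ^ 2 * (16 * Real.exp (-(2 * (ν * (d n - |t|))))))) := by
      have h1 : (2 * η) ^ 2 * (C * (Real.log q + Real.log (d n + 4)) / δ n + 1) *
          (ν ^ 2 * (16 * Real.exp (-(2 * (ν * (d n - |t|)))))) ≤
          (2 * η) ^ 2 * (A * (d n + 4) ^ 2) * (ν ^ 2 * (16 * Real.exp (-(2 * (ν * (d n - |t|)))))) :=
        mul_le_mul_of_nonneg_right (mul_le_mul_of_nonneg_left hMle (by positivity)) hK0
      simp only [hs] at Hd Hc ⊢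
      linarith only [Hd, Hc, h1]
    calc |1 / (2 * π) * ((fordHorizontalTerm χ.LFunction η s (σ - η) (σ + η) (d n)).im
            - (fordHorizontalTerm χ.LFunction η s (σ - η) (σ + η) (-d n)).im)|
        = 1 / (2 * π) * |(fordHorizontalTerm χ.LFunction η s (σ - η) (σ + η) (d n)).im
            - (fordHorizontalTerm χ.LFunction η s (σ - η) (σ + η) (-d n)).im| := by
          rw [abs_mul, abs_of_pos (by positivity)]
      _ ≤ 1 / (2 * π) * (‖fordHorizontalTerm χ.LFunction η s (σ - η) (σ + η) (d n)‖ +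
            ‖fordHorizontalTerm χ.LFunction η s (σ - η) (σ + η) (-d n)‖) := by
          refine mul_le_mul_of_nonneg_left ?_ (by positivity)
          exact (abs_sub _ _).trans (add_le_add (abs_im_le_norm _) (abs_im_le_norm _))
      _ ≤ 1 / (2 * π) * (2 * ((2 * η) ^ 2 * (A * (d n + 4) ^ 2) *
            (ν ^ 2 * (16 * Real.exp (-(2 * (ν * (d n - |t|)))))))) :=
          mul_le_mul_of_nonneg_left key (by positivity)
      _ = E n := by rw [hE, hBc, hexp]; ring
  -- Step D: limits
  have hd_tend : Tendsto (fun n : ℕ ↦ d n) atTop atTop :=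
    tendsto_atTop_mono hd_ge tendsto_natCast_atTop_atTop
  have hJ : Tendsto (fun n : ℕ ↦ ∫ y : ℝ in (-d n : ℝ)..d n, G y) atTop (𝓝 (∫ y, G y)) :=
    intervalIntegral_tendsto_integral hGint (tendsto_neg_atTop_atBot.comp hd_tend) hd_tend
  have hE0 : Tendsto E atTop (𝓝 0) := by
    have h := (FordZetaDetector.tendsto_sq_mul_exp_neg 4 (by positivity : 0 < 2 * ν)).comp hd_tend
    have h' := h.const_mul Bc
    rw [mul_zero] at h'
    refine h'.congr fun n ↦ ?_
    simp only [hE, Function.comp_apply]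
  have hlim : Tendsto (fun n : ℕ ↦ ZS + π / (8 * η ^ 2) * (∫ y : ℝ in (-d n : ℝ)..d n, G y) + E n)
      atTop (𝓝 (ZS + π / (8 * η ^ 2) * (∫ y, G y) + 0)) :=
    ((hJ.const_mul _).const_add _).add hE0
  rw [add_zero, hGeq] at hlim
  -- Step E: conclusion
  refine ge_of_tendsto hlim ?_
  filter_upwards [eventually_ge_atTop (max ⌈|t| + 2⌉₊ NS)] with n hn
  have hn1 : |t| + 2 ≤ (n : ℝ) := (Nat.le_ceil _).trans (by exact_mod_cast (le_max_left _ _).trans hn)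
  have hn2 : (NS : ℝ) ≤ n := by exact_mod_cast (le_max_right _ _).trans hn
  have h1 := hrect n hn1
  have h2 := hzeros n hn1 hn2
  have h3 := hhor n hn1
  have h4 := neg_abs_le (1 / (2 * π) * ((fordHorizontalTerm χ.LFunction η s (σ - η) (σ + η) (d n)).im
          - (fordHorizontalTerm χ.LFunction η s (σ - η) (σ + η) (-d n)).im))
  simp only [hF] at h1
  linarith

/-- **The detector for `L(s, χ)` in Ford's/Khale's parametrisation** (the substitution
`y = t + 2ηu/π` in `neg_re_logDeriv_LFunction_le`), the `L`-function case of Khale's Lemma 6.1 as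
it enters the proof of his Lemma 6.2:
`−Re (L'/L)(s, χ) ≤ Σ_{ρ ∈ S} m(ρ) Re h_η(ρ − s)`
`   + (1/4η) [∫ log|L(σ − η + i(t + 2ηu/π), χ)|/cosh²u du − ∫ log|L(σ + η + i(t + 2ηu/π), χ)|/cosh²u du]`.
[cite: Khale2024, Lemma 6.1] [cite: Ford2002Millennium, Lemma 2.2 and Lemma 4.1] -/
theorem ford_zero_detector_LFunction (hχ : χ ≠ 1) {σ t η : ℝ} (hη : 0 < η) (hσ : 1 ≤ σ)
    (hleft : 1 / 2 ≤ σ - η) (hright : σ + η ≤ 3)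
    (hgood : ∀ ρ : ℂ, χ.LFunction ρ = 0 → ρ.re ≠ σ - η)
    (S : Finset ℂ) (hS : ∀ ρ ∈ S, χ.LFunction ρ = 0 ∧ σ - η < ρ.re) :
    -(deriv χ.LFunction (σ + t * I) / χ.LFunction (σ + t * I)).re ≤
      (∑ ρ ∈ S, (zeroOrder χ ρ : ℝ) * (fordCot η (ρ - (σ + t * I))).re)
      + 1 / (4 * η) *
        ((∫ u : ℝ, Real.log ‖χ.LFunction ((σ - η : ℝ) + ((t + u * (2 * η / π) : ℝ) : ℂ) * I)‖ / Real.cosh u ^ 2)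
          - ∫ u : ℝ, Real.log ‖χ.LFunction ((σ + η : ℝ) + ((t + u * (2 * η / π) : ℝ) : ℂ) * I)‖ / Real.cosh u ^ 2) := by
  have h := neg_re_logDeriv_LFunction_le hχ (t := t) hη hσ hleft hright hgood S hS
  have hν0 : 0 < π / (2 * η) := by positivity
  have hπ : π ≠ 0 := Real.pi_pos.ne'
  rw [FordZetaDetector.integral_div_cosh_sq_comp (fun y ↦ Real.log ‖χ.LFunction ((σ - η : ℝ) + y * I)‖) t hν0,
    FordZetaDetector.integral_div_cosh_sq_comp (fun y ↦ Real.log ‖χ.LFunction ((σ + η : ℝ) + y * I)‖) t hν0] at h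
  have e1 : 1 / (π / (2 * η)) = 2 * η / π := by rw [one_div_div]
  have e2 : π / (8 * η ^ 2) * (2 * η / π) = 1 / (4 * η) := by
    field_simp; ring
  simp only [e1] at h
  rw [← mul_sub, ← mul_assoc, e2] at h
  exact h

end DirichletDetector

end Literature.NumberTheory.LFunctions
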